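import Literature.MathematicalPhysics.QuantumLattice.HubbardUVWeightJets
import Literature.MathematicalPhysics.QuantumLattice.HubbardResolventJets
import HarnessLib

/-!
# All-order band jets of the ultraviolet SYMBOL `Ψ_e(ω) = w(ω,e)·c/(−iω + e)`: Leibniz on (weight × resolvent), zero below the shell,
# `‖∂_eⁿ Ψ‖ ≤ n!·X·|c|·Σ_{i≤n} D(e)^i / max(|ω|,Λ/2)^{n+1−i}`, `D(e) = 2|e|/Λ² + 2/Λ`

Topic `MathematicalPhysics/QuantumLattice`; cell gate-hubbard-kl, K3 gen-8-flow S6 door (2) (design memo `HOME/p2-g10/JET-RESPONSE-DESIGN-p2g10.md`, item L2):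
`uvSymbolFnXi c Λ ω e = (w : ℂ)·R` with the weight jets of `HubbardUVWeightJets` (`‖∂ⁱw‖ ≤ i!·X·D(e)^i`) and the resolvent jets of `HubbardResolventJets`
(`‖∂ʲR‖ = |c|·j!/‖−iω+e‖^{j+1}`), Mathlib's Leibniz bound `norm_iteratedFDeriv_mul_le`, and `C(n,i)·i!·(n−i)! = n!`:

* `contDiff_uvSymbolFnXi` — `Ψ` is `C^∞` in the band at `ω ≠ 0`;
* `iteratedFDeriv_uvSymbolFnXi_eq_zero_of_lt` — below the shell (`ω² + e² < Λ²/4`) every band jet VANISHES;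
* `norm_iteratedFDeriv_uvSymbolFnXi_le_den` — `‖∂ⁿΨ(e)‖ ≤ n!·X·|c|·Σ_{i≤n} D(e)^i/‖−iω+e‖^{n−i+1}` everywhere;
* **`norm_iteratedFDeriv_uvSymbolFnXi_le`** — the ENVELOPE form `≤ n!·X·|c|·Σ_{i≤n} D(e)^i / max(|ω|,Λ/2)^{n−i+1}` everywhere (`0 < Λ`, `ω ≠ 0`).

`X` = the cutoff-jet hypothesis `‖χ₂^{(l)}‖ ≤ X`, `l ≤ n`.  Everything is proved; no definitions; no named facts.

## Sources

G. Benfatto, A. Giuliani, V. Mastropietro, Ann. Henri Poincaré 7 (2006) 809–898, §2.2 (2.36aa), App. A1 [`BenfattoGiulianiMastropietro2006`].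
-/

noncomputable section

namespace Literature.MathematicalPhysics.QuantumLattice

open scoped Nat
open Complex Finset

variable {c Λ ω : ℝ}

/-- `Ψ = (ofReal ∘ weight) · resolvent` as functions of the band. [cite: BenfattoGiulianiMastropietro2006, §2.2 (2.36aa)] -/
theorem uvSymbolFnXi_eq_mul (c Λ ω : ℝ) :
    uvSymbolFnXi c Λ ω = fun e : ℝ => (Complex.ofRealLI ∘ fun e : ℝ => uvWeightFn Λ ω e) e * resolventFnXi c 0 ω e := by
  funext e; rfl

/-- **`Ψ` is `C^∞` in the band** at a nonzero frequency. [cite: BenfattoGiulianiMastropietro2006, §2.2 (2.36aa)] -/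
theorem contDiff_uvSymbolFnXi (hω : ω ≠ 0) {N : ℕ∞} : ContDiff ℝ N (uvSymbolFnXi c Λ ω) := by
  have hω0 : ω + 0 ≠ 0 := by rwa [add_zero]
  rw [uvSymbolFnXi_eq_mul]
  exact (Complex.ofRealLI.contDiff.comp (contDiff_uvWeightFn_band Λ ω)).mul (contDiff_resolventFnXi (c := c) hω0)

/-- **Below the shell every band jet of `Ψ` vanishes** (`ω² + e² < Λ²/4`: `w ≡ 0` near `e`). [cite: BenfattoGiulianiMastropietro2006, §2.2 (2.36aa)] -/
theorem iteratedFDeriv_uvSymbolFnXi_eq_zero_of_lt (hΛ : 0 < Λ) {e : ℝ} (h : ω ^ 2 + e ^ 2 < Λ ^ 2 / 4) (n : ℕ) :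
    iteratedFDeriv ℝ n (uvSymbolFnXi c Λ ω) e = 0 := by
  have hlt : e ^ 2 + ω ^ 2 < Λ ^ 2 / 4 := by linarith
  have hopen : ∀ᶠ t in nhds e, t ^ 2 + ω ^ 2 < Λ ^ 2 / 4 :=
    (continuous_pow 2 |>.add continuous_const).continuousAt.eventually_lt continuousAt_const hlt
  have hev : uvSymbolFnXi c Λ ω =ᶠ[nhds e] fun _ => (0 : ℂ) := by
    filter_upwards [hopen] with t ht
    rw [uvSymbolFnXi, (uvWeightFn_eq_zero_of_lt hΛ ht).1, Complex.ofReal_zero, zero_mul]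
  rw [(hev.iteratedFDeriv ℝ n).eq_of_nhds]
  rcases Nat.eq_zero_or_pos n with hn | hn
  · subst hn; ext; simp
  · rw [iteratedFDeriv_const_of_ne (Nat.pos_iff_ne_zero.1 hn)]; rfl

/-- **Leibniz form with the exact resolvent denominators**: `‖∂ⁿΨ(e)‖ ≤ n!·X·|c|·Σ_{i≤n} D(e)^i/‖−iω+e‖^{n−i+1}` at every `e` (`0 < Λ`, `ω ≠ 0`).
[cite: BenfattoGiulianiMastropietro2006, §2.2 (2.36aa)] -/
theorem norm_iteratedFDeriv_uvSymbolFnXi_le_den (hΛ : 0 < Λ) (hω : ω ≠ 0) {n : ℕ} {X : ℝ}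
    (hX : ∀ l ≤ n, ∀ x : ℝ, ‖iteratedFDeriv ℝ l salmhoferCutoff x‖ ≤ X) (e : ℝ) :
    ‖iteratedFDeriv ℝ n (uvSymbolFnXi c Λ ω) e‖ ≤
      n ! * X * |c| * ∑ i ∈ range (n + 1), (2 * |e| / Λ ^ 2 + 2 / Λ) ^ i / ‖-I * ((ω + 0 : ℝ) : ℂ) + (e : ℂ)‖ ^ (n - i + 1) := by
  have hω0 : ω + 0 ≠ 0 := by rwa [add_zero]
  have hX0 : 0 ≤ X := (norm_nonneg _).trans (hX 0 (Nat.zero_le _) 0)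
  set D : ℝ := 2 * |e| / Λ ^ 2 + 2 / Λ with hDdef
  have hD0 : 0 ≤ D := by positivity
  set a : ℝ := ‖-I * ((ω + 0 : ℝ) : ℂ) + (e : ℂ)‖ with hadef
  have ha0 : 0 < a := norm_pos_iff.2 (shiftDen_ne_zero_of_freq_ne hω0 e)
  have hw : ContDiff ℝ (n : ℕ∞) (Complex.ofRealLI ∘ fun e : ℝ => uvWeightFn Λ ω e) :=
    Complex.ofRealLI.contDiff.comp (contDiff_uvWeightFn_band Λ ω)
  have hR : ContDiff ℝ (n : ℕ∞) (resolventFnXi c 0 ω) := contDiff_resolventFnXi hω0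
  rw [uvSymbolFnXi_eq_mul]
  refine (norm_iteratedFDeriv_mul_le hw hR e (n := n) le_rfl).trans ?_
  -- termwise
  have hterm : ∀ i ∈ range (n + 1),
      (n.choose i : ℝ) * ‖iteratedFDeriv ℝ i (Complex.ofRealLI ∘ fun e : ℝ => uvWeightFn Λ ω e) e‖ *
          ‖iteratedFDeriv ℝ (n - i) (resolventFnXi c 0 ω) e‖ ≤
        n ! * X * |c| * (D ^ i / a ^ (n - i + 1)) := by
    intro i hi
    have hin : i ≤ n := Nat.lt_succ_iff.1 (mem_range.1 hi)
    have h1 : ‖iteratedFDeriv ℝ i (Complex.ofRealLI ∘ fun e : ℝ => uvWeightFn Λ ω e) e‖ ≤ i ! * X * D ^ i := by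
      rw [Complex.ofRealLI.norm_iteratedFDeriv_comp_left ((contDiff_uvWeightFn_band Λ ω (N := i)).contDiffAt) le_rfl]
      exact norm_iteratedFDeriv_uvWeightFn_band_le hΛ ω (fun l hl x => hX l (hl.trans hin) x) e
    have h2 : ‖iteratedFDeriv ℝ (n - i) (resolventFnXi c 0 ω) e‖ ≤ |c| * (n - i) ! / a ^ (n - i + 1) := by
      rw [norm_iteratedFDeriv_eq_norm_iteratedDeriv, norm_iteratedDeriv_resolventFnXi hω0]
    have hchoose : (n.choose i : ℝ) * (i ! : ℝ) * ((n - i) ! : ℝ) = n ! := by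
      exact_mod_cast Nat.choose_mul_factorial_mul_factorial hin
    calc (n.choose i : ℝ) * ‖iteratedFDeriv ℝ i (Complex.ofRealLI ∘ fun e : ℝ => uvWeightFn Λ ω e) e‖ *
          ‖iteratedFDeriv ℝ (n - i) (resolventFnXi c 0 ω) e‖
        ≤ (n.choose i : ℝ) * (i ! * X * D ^ i) * (|c| * (n - i) ! / a ^ (n - i + 1)) := by
          gcongr
      _ = (n.choose i : ℝ) * (i ! : ℝ) * ((n - i) ! : ℝ) * X * |c| * (D ^ i / a ^ (n - i + 1)) := by ring
      _ = n ! * X * |c| * (D ^ i / a ^ (n - i + 1)) := by rw [hchoose]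
  refine (sum_le_sum hterm).trans (le_of_eq ?_)
  rw [← mul_sum]

/-- **The ENVELOPE form of the all-order band jets**: `‖∂ⁿΨ(e)‖ ≤ n!·X·|c|·Σ_{i≤n} D(e)^i / max(|ω|,Λ/2)^{n−i+1}`, `D(e) = 2|e|/Λ² + 2/Λ`, at every `e`
(`0 < Λ`, `ω ≠ 0`): below the shell the jet vanishes, above it `‖−iω+e‖ ≥ max(|ω|, Λ/2)`. [cite: BenfattoGiulianiMastropietro2006, §2.2 (2.36aa)] -/
theorem norm_iteratedFDeriv_uvSymbolFnXi_le (hΛ : 0 < Λ) (hω : ω ≠ 0) {n : ℕ} {X : ℝ}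
    (hX : ∀ l ≤ n, ∀ x : ℝ, ‖iteratedFDeriv ℝ l salmhoferCutoff x‖ ≤ X) (e : ℝ) :
    ‖iteratedFDeriv ℝ n (uvSymbolFnXi c Λ ω) e‖ ≤
      n ! * X * |c| * ∑ i ∈ range (n + 1), (2 * |e| / Λ ^ 2 + 2 / Λ) ^ i / max |ω| (Λ / 2) ^ (n - i + 1) := by
  have hX0 : 0 ≤ X := (norm_nonneg _).trans (hX 0 (Nat.zero_le _) 0)
  have hm : 0 < max |ω| (Λ / 2) := uvEnv_pos hΛ ω
  have hD0 : 0 ≤ 2 * |e| / Λ ^ 2 + 2 / Λ := by positivity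
  by_cases hlt : ω ^ 2 + e ^ 2 < Λ ^ 2 / 4
  · rw [iteratedFDeriv_uvSymbolFnXi_eq_zero_of_lt hΛ hlt, norm_zero]
    exact mul_nonneg (by positivity) (sum_nonneg fun i _ => by positivity)
  · have hge : Λ ^ 2 / 4 ≤ ω ^ 2 + e ^ 2 := not_lt.1 hlt
    have hma : max |ω| (Λ / 2) ≤ ‖-I * ((ω + 0 : ℝ) : ℂ) + (e : ℂ)‖ := max_le_norm_uvDen hΛ hge
    refine (norm_iteratedFDeriv_uvSymbolFnXi_le_den hΛ hω hX e).trans ?_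
    refine mul_le_mul_of_nonneg_left (sum_le_sum fun i _ => ?_) (by positivity)
    exact div_le_div_of_nonneg_left (by positivity) (by positivity) (pow_le_pow_left₀ hm.le hma _)

end Literature.MathematicalPhysics.QuantumLattice

end
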